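import Mathlib
import Summits.Ventures.PercRepro2.Defs

/-!
# The finite-sum percolation law is Mathlib's product Bernoulli measure
(blind cell PercRepro2, typer-1 g15, 2026-08-26)

The cell's `weight` / `prob` / `expect` (`Defs.lean`) are explicit finite sums over the
configuration space `Config E = E → Bool`.  This file identifies them with the measure-theoretic
objects of Mathlib, so that every theorem of the cell stated with `prob` / `expect` is a theorem
about the standard product of Bernoulli laws:

* `percMeasure p := Measure.pi (fun e => Ber(true, false, p e))` — the product over the edges of
  Mathlib's `ProbabilityTheory.bernoulliMeasure` (edge `e` open with probability `p e : I`);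
* `percMeasure_real_singleton : (percMeasure p).real {ω} = weight (fun e => (p e : ℝ)) ω`;
* `percMeasure_real_apply : (percMeasure p).real A = prob (fun e => (p e : ℝ)) A` for EVERY
  event `A` (every subset of the finite configuration space is measurable);
* `integral_percMeasure : ∫ ω, f ω ∂(percMeasure p) = expect (fun e => (p e : ℝ)) f`;
* `percMeasure_real_cylinder` (the finite-dimensional laws), `map_eval_percMeasure` (the marginal of
  one edge is its Bernoulli law), `iIndepFun_percMeasure` (the edge states are independent,
  Mathlib's `iIndepFun`);
* constant weight `q`: `setBernoulli_univ_eq_map :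
  setBer(Set.univ, q) = (percMeasure fun _ => q).map toSet` — Mathlib's
  `ProbabilityTheory.setBernoulli` (the product of `q`-Bernoulli laws on the set of edges, the
  object `setBer(E(G), q)` of the programme's starting statement) is the image of the cell's law
  under the canonical bijection `toSet ω = {e | ω e = true}` between configurations and open-edge
  sets; `setBernoulli_univ_real_apply : setBer(Set.univ, q).real S =
  prob (fun _ => (q : ℝ)) (toSet ⁻¹' S)`.

Own work; standard axioms.  Weights live in the unit interval `I` (Mathlib's convention for
Bernoulli laws); the cell's real-valued `p : E → ℝ` with `0 ≤ p e ≤ 1` is recovered as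
`fun e => (p e : ℝ)`.
-/

namespace Summit.Ventures.PercRepro2

namespace MeasureBridge

open MeasureTheory ProbabilityTheory unitInterval
open scoped ENNReal

variable {E : Type*} [Fintype E] [DecidableEq E]

/-- The law of one edge: open (`true`) with probability `q`, closed (`false`) with probability
`1 - q` — Mathlib's `bernoulliMeasure true false q`. -/
noncomputable def edgeLaw (q : I) : Measure Bool := bernoulliMeasure true false q

/-- `edgeLaw q` is a probability measure. -/
instance (q : I) : IsProbabilityMeasure (edgeLaw q) := by
  unfold edgeLaw; infer_instance

/-- The mass of one state of an edge is the cell's `edgeFactor`. -/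
lemma edgeLaw_real_singleton (q : I) (b : Bool) :
    (edgeLaw q).real {b} = edgeFactor (q : ℝ) b := by
  cases b
  · rw [edgeLaw, bernoulliMeasure_real_apply_of_notMem_of_mem q (measurableSet_singleton _)
      (by simp) (by simp)]
    rfl
  · rw [edgeLaw, bernoulliMeasure_real_apply_of_mem_of_notMem q (measurableSet_singleton _)
      (by simp) (by simp)]
    rfl

/-- The product Bernoulli measure on the configuration space: the edges are independent, edge
`e` open with probability `p e`. -/
noncomputable def percMeasure (p : E → I) : Measure (Config E) :=
  Measure.pi fun e => edgeLaw (p e)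

/-- `percMeasure p` is a probability measure. -/
instance (p : E → I) : IsProbabilityMeasure (percMeasure p) := by
  unfold percMeasure; infer_instance

omit [DecidableEq E] in
/-- **Singletons**: the mass of one configuration is the cell's product weight. -/
theorem percMeasure_real_singleton (p : E → I) (ω : Config E) :
    (percMeasure p).real {ω} = weight (fun e => (p e : ℝ)) ω := by
  rw [percMeasure, weight_apply, measureReal_def, Measure.pi_singleton, ENNReal.toReal_prod]
  exact Finset.prod_congr rfl fun e _ => by rw [← measureReal_def, edgeLaw_real_singleton]

/-- **Events**: the probability of any event under the product Bernoulli measure is the cell's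
finite sum `prob`. -/
theorem percMeasure_real_apply (p : E → I) (A : Set (Config E)) :
    (percMeasure p).real A = prob (fun e => (p e : ℝ)) A := by
  classical
  calc (percMeasure p).real A
      = (percMeasure p).real (↑(A.toFinset)) := by rw [Set.coe_toFinset]
    _ = ∑ ω ∈ A.toFinset, (percMeasure p).real {ω} := (sum_measureReal_singleton _).symm
    _ = ∑ ω ∈ A.toFinset, weight (fun e => (p e : ℝ)) ω :=
        Finset.sum_congr rfl fun ω _ => percMeasure_real_singleton p ω
    _ = ∑ ω, A.indicator (weight (fun e => (p e : ℝ))) ω := by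
        rw [Finset.sum_indicator_eq_sum_filter]
        congr 1
        ext ω
        simp
    _ = prob (fun e => (p e : ℝ)) A := rfl

/-- The `ℝ≥0∞`-valued form of `percMeasure_real_apply`. -/
theorem percMeasure_apply (p : E → I) (A : Set (Config E)) :
    percMeasure p A = ENNReal.ofReal (prob (fun e => (p e : ℝ)) A) := by
  rw [← percMeasure_real_apply, measureReal_def, ENNReal.ofReal_toReal (measure_ne_top _ _)]

/-- **Expectations**: the Bochner integral against the product Bernoulli measure is the cell's
finite sum `expect`. -/
theorem integral_percMeasure (p : E → I) (f : Config E → ℝ) :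
    ∫ ω, f ω ∂(percMeasure p) = expect (fun e => (p e : ℝ)) f := by
  rw [integral_fintype Integrable.of_finite, expect]
  exact Finset.sum_congr rfl fun ω _ => by rw [percMeasure_real_singleton, smul_eq_mul]

/-- **Cylinders** (the finite-dimensional laws): the states of the edges of `F` are prescribed by
`c` with probability `∏ e ∈ F, (p e if c e else 1 - p e)`. -/
theorem percMeasure_real_cylinder (p : E → I) (F : Finset E) (c : Config E) :
    (percMeasure p).real (cylinder F c) = ∏ e ∈ F, edgeFactor (p e : ℝ) (c e) := by
  rw [percMeasure_real_apply, prob_cylinder]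

omit [DecidableEq E] in
/-- **Marginals**: the law of the state of one edge is its Bernoulli law. -/
theorem map_eval_percMeasure (p : E → I) (e : E) :
    (percMeasure p).map (fun ω : Config E => ω e) = edgeLaw (p e) :=
  (measurePreserving_eval (fun e => edgeLaw (p e)) e).map_eq

omit [DecidableEq E] in
/-- **Independence**: the states of the edges are independent random variables under
`percMeasure p` (Mathlib's `iIndepFun`). -/
theorem iIndepFun_percMeasure (p : E → I) :
    iIndepFun (fun e (ω : Config E) => ω e) (percMeasure p) :=
  iIndepFun_pi (X := fun _ => id) (μ := fun e => edgeLaw (p e)) fun _ => aemeasurable_id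

/-! ## Constant weight: Mathlib's `setBer(E, q)` -/

/-- The set of open edges of a configuration. -/
def toSet (ω : Config E) : Set E := {e | ω e = true}

omit [Fintype E] [DecidableEq E] in
/-- Membership in `toSet`. -/
@[simp] lemma mem_toSet {ω : Config E} {e : E} : e ∈ toSet ω ↔ ω e = true := Iff.rfl

open scoped Classical in
/-- `toSet` is a bijection between configurations and sets of edges. -/
noncomputable def toSetEquiv : Config E ≃ Set E where
  toFun := toSet
  invFun s e := decide (e ∈ s)
  left_inv ω := by funext e; simp [toSet]
  right_inv s := by ext e; simp [toSet]

omit [Fintype E] [DecidableEq E] in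
/-- `toSetEquiv` acts as `toSet`. -/
@[simp] lemma toSetEquiv_apply (ω : Config E) : toSetEquiv ω = toSet ω := rfl

omit [Fintype E] [DecidableEq E] in
/-- The inverse of `toSetEquiv`: the configuration opening exactly the edges of `s`. -/
lemma toSetEquiv_symm_apply_eq_true_iff (s : Set E) (e : E) :
    toSetEquiv.symm s e = true ↔ e ∈ s := by
  simp [toSetEquiv]

omit [Fintype E] [DecidableEq E] in
/-- The preimage of a singleton under `toSet`. -/
lemma toSet_preimage_singleton (s : Set E) :
    toSet ⁻¹' ({s} : Set (Set E)) = {toSetEquiv.symm s} := by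
  ext ω
  simp only [Set.mem_preimage, Set.mem_singleton_iff]
  constructor
  · rintro rfl
    exact (toSetEquiv.symm_apply_apply ω).symm
  · rintro rfl
    exact toSetEquiv.apply_symm_apply s

omit [Fintype E] [DecidableEq E] in
/-- `toSet` of the configuration opening exactly the edges of `s` is `s`. -/
lemma toSet_symm (s : Set E) : toSet (toSetEquiv.symm s) = s := toSetEquiv.apply_symm_apply s

omit [DecidableEq E] in
/-- `toSet` is measurable (the configuration space is finite with measurable singletons). -/
lemma measurable_toSet : Measurable (toSet : Config E → Set E) :=
  measurable_of_countable _

omit [DecidableEq E] in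
/-- The open-edge set as a `Finset`. -/
lemma toSet_eq_coe_filter (ω : Config E) :
    toSet ω = ↑(Finset.univ.filter fun e => ω e = true) := by
  ext e; simp [toSet]

omit [DecidableEq E] in
/-- The closed-edge set as a `Finset`. -/
lemma univ_diff_toSet_eq_coe_filter (ω : Config E) :
    Set.univ \ toSet ω = ↑(Finset.univ.filter fun e => ¬ ω e = true) := by
  ext e; simp [toSet]

omit [DecidableEq E] in
/-- With a constant weight `q` the product weight is `q ^ #open · (1 - q) ^ #closed`. -/
lemma weight_const (q : ℝ) (ω : Config E) :
    weight (fun _ => q) ω = q ^ (toSet ω).ncard * (1 - q) ^ (Set.univ \ toSet ω).ncard := by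
  rw [weight_apply, univ_diff_toSet_eq_coe_filter, toSet_eq_coe_filter, Set.ncard_coe_finset,
    Set.ncard_coe_finset]
  simp only [edgeFactor]
  rw [Finset.prod_ite, Finset.prod_const, Finset.prod_const]

/-- `ENNReal.ofReal` of a point of the unit interval. -/
lemma ofReal_coe (q : I) : ENNReal.ofReal (q : ℝ) = (toNNReal q : ℝ≥0∞) := by
  rw [← coe_toNNReal q, ENNReal.ofReal_coe_nnreal]

/-- `ENNReal.ofReal` of the complement of a point of the unit interval. -/
lemma ofReal_one_sub_coe (q : I) : ENNReal.ofReal (1 - (q : ℝ)) = (toNNReal (σ q) : ℝ≥0∞) := by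
  rw [← ENNReal.ofReal_coe_nnreal]
  rfl

/-- **The set-Bernoulli law**: Mathlib's `setBer(Set.univ, q)` on the finite edge set `E` is the
image of the cell's product law under `toSet`. -/
theorem setBernoulli_univ_eq_map (q : I) :
    setBer((Set.univ : Set E), q) = (percMeasure fun _ => q).map toSet := by
  classical
  refine Measure.ext_of_singleton fun s => ?_
  rw [Measure.map_apply measurable_toSet (measurableSet_singleton s), toSet_preimage_singleton,
    setBernoulli_singleton q (Set.subset_univ s) Set.finite_univ, percMeasure_apply,
    prob_eq_sum_filter]
  have hfilter : (Finset.univ.filter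
      fun ω : Config E => ω ∈ ({toSetEquiv.symm s} : Set (Config E))) = {toSetEquiv.symm s} := by
    ext ω; simp
  rw [hfilter, Finset.sum_singleton, weight_const, toSet_symm,
    ENNReal.ofReal_mul (pow_nonneg q.2.1 _), ENNReal.ofReal_pow q.2.1,
    ENNReal.ofReal_pow (sub_nonneg.2 q.2.2), ofReal_coe, ofReal_one_sub_coe]

/-- **Events of the set-Bernoulli law**: `setBer(E, q)` of a family of edge sets is the cell's
`prob` of the corresponding configurations. -/
theorem setBernoulli_univ_real_apply (q : I) (S : Set (Set E)) :
    setBer((Set.univ : Set E), q).real S = prob (fun _ => (q : ℝ)) (toSet ⁻¹' S) := by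
  rw [setBernoulli_univ_eq_map, measureReal_def,
    Measure.map_apply measurable_toSet MeasurableSet.of_discrete, ← measureReal_def,
    percMeasure_real_apply]

end MeasureBridge

end Summit.Ventures.PercRepro2
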